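import Literature.Analysis.FluidPDE.TorusTransversalModesHeatFlow
import Literature.Analysis.FunctionSpaces.TorusFourierCalculus
import HarnessLib

/-!
# C167 `Lietz2026` — Part A: the two-scale parallel shear family (support module of `SoloRefuteLietz2026`)

D-0090 «where NS proofs break» map, cell `ns-claims`; refuter of record ns-claims-refuter-6 g4. This file carries NO
claim-specific statement: it builds the witness family used by `SoloRefuteLietz2026.not_Step_T133_uniform`.

`u₀^{(N)} = datum a b N = Torus.realTrigPoly {±e₀, ±N e₀} c = (0, a sin 2πx₀ + b sin 2πN x₀, 0)` on `𝕋³`: smooth,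
divergence-free, mean-zero (`N ≠ 0`); its exact Navier–Stokes evolution is the heat flow
`flow ν a b N = TransversalModes.heatFlow` (parallel shear: the nonlinear term vanishes, pressure `0`; tree
`TransversalModes.isClassicalNSSolutionOn_heatFlow_Ici`, Majda–Bertozzi 2002 §1.2). Fourier table
`û₀(ξ) = −(i/2)·amp(ξ)·e₁` on the four modes, energy `Torus.kineticEnergy u₀ = (a² + b²)/4`,
`Torus.gradNormSq u₀ = 2π²(a² + N²b²)`; the FIXED-LEDGER normalisation `a_N² = 2 − 2/(N² − 1)`, `b_N² = 2/(N² − 1)`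
gives `E = ½`, `‖∇u₀‖²₂ = 8π²` for every `N ≥ 2` while the high-mode content `N² b_N²/2 = N²/(N² − 1)` stays `> 1`.

WHAT THIS IS NOT: not a claim about NS regularity or blow-up; not a claim about any author beyond the typed
locator. [cite: MajdaBertozzi2002, §1.2] [cite: Lietz2026]
-/

set_option linter.dupNamespace false

noncomputable section

open Set Function MeasureTheory UnitAddTorus
open scoped InnerProductSpace ComplexConjugate ENNReal

namespace Summit.NavierStokesRegularity.NavierStokesRegularity.Theorems.Lietz2026

open Literature.Analysis.FunctionSpaces Literature.Analysis.FunctionSpaces.Torus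
open Literature.Analysis.FluidPDE Literature.Analysis.FluidPDE.TransversalModes

/-- Wave vector `m e₀`. -/
def ax (m : ℤ) : Fin 3 → ℤ := fun i => if i = 0 then m else 0

/-- Component `0` of `m e₀` is `m`. [folklore] -/
@[simp] theorem ax_zero_apply (m : ℤ) : ax m 0 = m := by simp [ax]
/-- Component `1` of `m e₀` vanishes. [folklore] -/
@[simp] theorem ax_one_apply (m : ℤ) : ax m 1 = 0 := by simp [ax]
/-- Component `2` of `m e₀` vanishes. [folklore] -/
@[simp] theorem ax_two_apply (m : ℤ) : ax m 2 = 0 := by simp [ax]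

/-- `-(m e₀) = (−m) e₀`. [folklore] -/
theorem neg_ax (m : ℤ) : -ax m = ax (-m) := by
  funext i; by_cases h : i = 0 <;> simp [ax, h]

/-- `m e₀ = m′ e₀ ↔ m = m′`. [folklore] -/
theorem ax_inj {m m' : ℤ} : ax m = ax m' ↔ m = m' := by
  constructor
  · intro h; have := congrFun h 0; simpa [ax] using this
  · rintro rfl; rfl

/-- `m e₀ = 0 ↔ m = 0`. [folklore] -/
theorem ax_eq_zero_iff {m : ℤ} : ax m = 0 ↔ m = 0 := by
  constructor
  · intro h; have := congrFun h 0; simpa [ax] using this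
  · rintro rfl; funext i; simp [ax]

/-- `|m e₀|² = m²`. [folklore] -/
theorem freqNormSq_ax (m : ℤ) : freqNormSq (ax m) = (m : ℝ) ^ 2 := by
  simp [freqNormSq, ax]

/-- The four active modes `{e₀, -e₀, N e₀, -N e₀}`. -/
def modes (N : ℕ) : Finset (Fin 3 → ℤ) := {ax 1, ax (-1), ax N, ax (-N)}

/-- Scalar amplitude profile on `ℤ`, odd: `1 ↦ a, -1 ↦ -a, N ↦ b, -N ↦ -b`. -/
def prof (a b : ℝ) (N : ℕ) (m : ℤ) : ℝ :=
  a * ((if m = 1 then 1 else 0) - (if m = -1 then 1 else 0)) +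
    b * ((if m = (N : ℤ) then 1 else 0) - (if m = -(N : ℤ) then 1 else 0))

/-- The amplitude profile is odd. [folklore] -/
theorem prof_neg (a b : ℝ) (N : ℕ) (m : ℤ) : prof a b N (-m) = -prof a b N m := by
  have h1 : (-m = (1:ℤ)) ↔ (m = -1) := by omega
  have h2 : (-m = (N:ℤ)) ↔ (m = -(N:ℤ)) := by omega
  have h3 : (-m = (-1:ℤ)) ↔ (m = 1) := by omega
  have h4 : (-m = -(N:ℤ)) ↔ (m = (N:ℤ)) := by omega
  simp only [prof, h1, h2, h3, h4]
  ring

/-- Amplitude of the wave vector `k`: `prof (k 0)` on the `e₀`-axis, `0` off it. -/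
def amp (a b : ℝ) (N : ℕ) (k : Fin 3 → ℤ) : ℝ :=
  if k 1 = 0 ∧ k 2 = 0 then prof a b N (k 0) else 0

/-- The amplitude is odd in the wave vector. [folklore] -/
theorem amp_neg (a b : ℝ) (N : ℕ) (k : Fin 3 → ℤ) : amp a b N (-k) = -amp a b N k := by
  unfold amp
  simp only [Pi.neg_apply, neg_eq_zero]
  split_ifs <;> simp [prof_neg]

/-- The amplitude on the axis `ξ = m e₀` is the profile at `m`. [folklore] -/
theorem amp_ax (a b : ℝ) (N : ℕ) (m : ℤ) : amp a b N (ax m) = prof a b N m := by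
  simp [amp, ax]

/-- The unit vector `e₁ ∈ ℂ³`. -/
def e1 : EuclideanSpace ℂ (Fin 3) := EuclideanSpace.single 1 (1 : ℂ)

/-- Components of `e₁ = (0, 1, 0)`. [folklore] -/
@[simp] theorem e1_apply (i : Fin 3) : e1 i = if i = 1 then 1 else 0 := by
  simp [e1]

/-- `‖e₁‖ = 1`. [folklore] -/
theorem norm_e1 : ‖e1‖ = 1 := by simp [e1]

/-- `e₁` is real. [folklore] -/
theorem conjVec_e1 : EuclideanSpace.conjVec e1 = e1 := by
  ext i; by_cases h : i = 1 <;> simp [h]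

/-- Coefficient family `c_k = (-i/2)·amp(k)·e₁`, so that `Re Σ c_k e_k = (0, Σ amp sin, 0)`. -/
def coef (a b : ℝ) (N : ℕ) (k : Fin 3 → ℤ) : EuclideanSpace ℂ (Fin 3) :=
  ((-Complex.I / 2) * (amp a b N k : ℂ)) • e1

/-- The coefficients have no `x₀`-component. [folklore] -/
theorem coef_apply_zero (a b : ℝ) (N : ℕ) (k : Fin 3 → ℤ) : coef a b N k 0 = 0 := by
  simp [coef]

/-- The coefficients have no `x₂`-component. [folklore] -/
theorem coef_apply_two (a b : ℝ) (N : ℕ) (k : Fin 3 → ℤ) : coef a b N k 2 = 0 := by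
  simp [coef]

/-- Reality condition `c(−ξ) = conj c(ξ)` for the family. [folklore] -/
theorem isConjSymm_coef (a b : ℝ) (N : ℕ) : IsConjSymm (coef a b N) := by
  intro k
  rw [coef, coef, amp_neg, EuclideanSpace.conjVec_smul, conjVec_e1]
  congr 1
  simp only [map_mul, map_div₀, map_neg, Complex.conj_I, Complex.conj_ofReal, map_ofNat,
    Complex.ofReal_neg]
  ring

/-- `‖c(ξ)‖ = |amp(ξ)|/2`. [folklore] -/
theorem norm_coef (a b : ℝ) (N : ℕ) (k : Fin 3 → ℤ) : ‖coef a b N k‖ = |amp a b N k| / 2 := by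
  rw [coef, norm_smul, norm_e1, mul_one, norm_mul, norm_div, norm_neg, Complex.norm_I,
    Complex.norm_real, Real.norm_eq_abs]
  norm_num
  ring

/-- `‖c(ξ)‖² = amp(ξ)²/4`. [folklore] -/
theorem norm_coef_sq (a b : ℝ) (N : ℕ) (k : Fin 3 → ℤ) :
    ‖coef a b N k‖ ^ 2 = (amp a b N k) ^ 2 / 4 := by
  rw [norm_coef, div_pow, sq_abs]; norm_num

/-- `modes N` is symmetric. -/
theorem modes_symm (N : ℕ) : ∀ k ∈ modes N, -k ∈ modes N := by
  intro k hk
  simp only [modes, Finset.mem_insert, Finset.mem_singleton] at hk ⊢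
  rcases hk with rfl | rfl | rfl | rfl <;> simp [neg_ax]

/-- The zero mode is absent (`N ≠ 0`): the data are mean-zero. [folklore] -/
theorem zero_not_mem_modes {N : ℕ} (hN : N ≠ 0) : (0 : Fin 3 → ℤ) ∉ modes N := by
  simp only [modes, Finset.mem_insert, Finset.mem_singleton, not_or]
  refine ⟨?_, ?_, ?_, ?_⟩ <;> (intro h; have := ax_eq_zero_iff.mp h.symm; omega)

/-- All modes lie on the `e₀`-axis. [folklore] -/
theorem modes_streamwise (N : ℕ) : ∀ k ∈ modes N, k 1 = 0 ∧ k 2 = 0 := by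
  intro k hk
  simp only [modes, Finset.mem_insert, Finset.mem_singleton] at hk
  rcases hk with rfl | rfl | rfl | rfl <;> simp

/-- Cross-transversality (parallel shear geometry). -/
theorem cross_coef (a b : ℝ) (N : ℕ) :
    ∀ k ∈ modes N, ∀ l ∈ modes N, ∑ j, (l j : ℂ) * coef a b N k j = 0 :=
  crossTransversal_of_streamwise (modes_streamwise N) fun k _ => coef_apply_zero a b N k

/-- Transversality `ξ · c(ξ) = 0` (divergence-free). [folklore] -/
theorem isTransversal_coef (a b : ℝ) (N : ℕ) : IsTransversal (modes N) (coef a b N) :=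
  fun k hk => cross_coef a b N k hk k hk

/-- The datum `u₀ = (0, a sin 2πx₀ + b sin 2πNx₀, 0)`. -/
def datum (a b : ℝ) (N : ℕ) : UnitAddTorus (Fin 3) → EuclideanSpace ℝ (Fin 3) :=
  realTrigPoly (modes N) (coef a b N)

/-- Its exact Navier–Stokes evolution (heat flow of each mode). -/
def flow (ν a b : ℝ) (N : ℕ) : ℝ → UnitAddTorus (Fin 3) → EuclideanSpace ℝ (Fin 3) :=
  TransversalModes.heatFlow ν (modes N) (coef a b N)

/-- The flow starts at the datum. [folklore] -/
theorem flow_zero (ν a b : ℝ) (N : ℕ) : flow ν a b N 0 = datum a b N :=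
  heatFlow_zero ν _ _

/-- The datum is `C^∞`. [folklore] -/
theorem isSmooth_datum (a b : ℝ) (N : ℕ) : IsSmooth (datum a b N) := isSmooth_realTrigPoly _ _

/-- The datum is divergence-free. [folklore] -/
theorem isDivFree_datum (a b : ℝ) (N : ℕ) : IsDivFree (datum a b N) :=
  isDivFree_realTrigPoly (isTransversal_coef a b N)

/-- Classical NS solution on `[0, ∞)`, zero force, zero pressure. -/
theorem isClassicalNSSolutionOn_flow (ν a b : ℝ) (N : ℕ) :
    Torus.IsClassicalNSSolutionOn (Ici 0) ν 0 (flow ν a b N) (fun _ _ => (0 : ℝ)) :=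
  isClassicalNSSolutionOn_heatFlow_Ici ν (cross_coef a b N)

/-- Mean zero (no zero mode). -/
theorem hasZeroMean_realTrigPoly_of_zero_not_mem' {S : Finset (Fin 3 → ℤ)} (hS0 : (0 : Fin 3 → ℤ) ∉ S)
    (C : (Fin 3 → ℤ) → EuclideanSpace ℂ (Fin 3)) : HasZeroMean (realTrigPoly S C) := by
  show ∫ x, EuclideanSpace.realPart (trigPoly S C x) = 0
  rw [EuclideanSpace.realPart.integral_comp_comm (continuous_trigPoly S C).integrable_unitAddTorus]
  have h : ∫ x, trigPoly S C x = 0 := by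
    simp_rw [trigPoly_apply]
    have hint : ∀ k ∈ S, Integrable (fun x : UnitAddTorus (Fin 3) => mFourier k x • C k) volume :=
      fun k _ => ((mFourier k).continuous.smul continuous_const).integrable_unitAddTorus
    rw [integral_finsetSum _ hint]
    refine Finset.sum_eq_zero fun k hk => ?_
    have hk0 : k ≠ 0 := fun h => hS0 (h ▸ hk)
    rw [integral_smul_const, integral_mFourier, if_neg hk0, zero_smul]
  rw [h, map_zero]

/-- The datum has zero mean (`N ≠ 0`). [folklore] -/
theorem hasZeroMean_datum (a b : ℝ) {N : ℕ} (hN : N ≠ 0) : HasZeroMean (datum a b N) :=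
  hasZeroMean_realTrigPoly_of_zero_not_mem' (zero_not_mem_modes hN) _

/-! ## Fourier table -/

/-- Fourier coefficients of the datum: `c(ξ)` on the modes, `0` elsewhere. [folklore] -/
theorem mFourierCoeff_datum (a b : ℝ) (N : ℕ) (k : Fin 3 → ℤ) :
    mFourierCoeff (EuclideanSpace.complexify ∘ datum a b N) k =
      if k ∈ modes N then coef a b N k else 0 :=
  mFourierCoeff_realTrigPoly (modes_symm N) (isConjSymm_coef a b N) k

/-- Values of the profile (needs `2 ≤ N` so that the four modes are distinct). -/
theorem prof_one (a b : ℝ) {N : ℕ} (hN : 2 ≤ N) : prof a b N 1 = a := by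
  have h1 : (1:ℤ) ≠ (N:ℤ) := by omega
  have h2 : (1:ℤ) ≠ -(N:ℤ) := by omega
  simp [prof, h1, h2]

/-- Profile at `m = −1` (`N ≥ 2`). [folklore] -/
theorem prof_neg_one (a b : ℝ) {N : ℕ} (hN : 2 ≤ N) : prof a b N (-1) = -a := by
  rw [prof_neg, prof_one a b hN]

/-- Profile at `m = N` (`N ≥ 2`). [folklore] -/
theorem prof_N (a b : ℝ) {N : ℕ} (hN : 2 ≤ N) : prof a b N N = b := by
  have h1 : (N:ℤ) ≠ 1 := by omega
  have h2 : (N:ℤ) ≠ -1 := by omega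
  have h3 : (N:ℤ) ≠ -(N:ℤ) := by omega
  simp [prof, h1, h2, h3]

/-- Profile at `m = −N` (`N ≥ 2`). [folklore] -/
theorem prof_neg_N (a b : ℝ) {N : ℕ} (hN : 2 ≤ N) : prof a b N (-(N:ℤ)) = -b := by
  rw [prof_neg, prof_N a b hN]

/-- `‖c(e₀)‖² = a²/4`. [folklore] -/
theorem norm_coef_ax_one_sq (a b : ℝ) {N : ℕ} (hN : 2 ≤ N) : ‖coef a b N (ax 1)‖ ^ 2 = a ^ 2 / 4 := by
  rw [norm_coef_sq, amp_ax, prof_one a b hN]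

/-- `‖c(−e₀)‖² = a²/4`. [folklore] -/
theorem norm_coef_ax_neg_one_sq (a b : ℝ) {N : ℕ} (hN : 2 ≤ N) :
    ‖coef a b N (ax (-1))‖ ^ 2 = a ^ 2 / 4 := by
  rw [norm_coef_sq, amp_ax, prof_neg_one a b hN, neg_sq]

/-- `‖c(N e₀)‖² = b²/4`. [folklore] -/
theorem norm_coef_ax_N_sq (a b : ℝ) {N : ℕ} (hN : 2 ≤ N) : ‖coef a b N (ax N)‖ ^ 2 = b ^ 2 / 4 := by
  rw [norm_coef_sq, amp_ax, prof_N a b hN]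

/-- `‖c(−N e₀)‖² = b²/4`. [folklore] -/
theorem norm_coef_ax_neg_N_sq (a b : ℝ) {N : ℕ} (hN : 2 ≤ N) :
    ‖coef a b N (ax (-(N:ℤ)))‖ ^ 2 = b ^ 2 / 4 := by
  rw [norm_coef_sq, amp_ax, prof_neg_N a b hN, neg_sq]

/-- Sum of a function over the four modes. -/
theorem sum_modes {N : ℕ} (hN : 2 ≤ N) (f : (Fin 3 → ℤ) → ℝ) :
    ∑ k ∈ modes N, f k = f (ax 1) + f (ax (-1)) + f (ax N) + f (ax (-(N:ℤ))) := by
  have h12 : ax 1 ≠ ax (-1) := by rw [ne_eq, ax_inj]; omega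
  have h13 : ax 1 ≠ ax N := by rw [ne_eq, ax_inj]; omega
  have h14 : ax 1 ≠ ax (-(N:ℤ)) := by rw [ne_eq, ax_inj]; omega
  have h23 : ax (-1) ≠ ax N := by rw [ne_eq, ax_inj]; omega
  have h24 : ax (-1) ≠ ax (-(N:ℤ)) := by rw [ne_eq, ax_inj]; omega
  have h34 : ax (N:ℤ) ≠ ax (-(N:ℤ)) := by rw [ne_eq, ax_inj]; omega
  rw [modes, Finset.sum_insert (by simp [h12, h13, h14]), Finset.sum_insert (by simp [h23, h24]),
    Finset.sum_pair h34]
  ring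

/-- Kinetic energy `½∫‖u₀‖² = (a² + b²)/4`. -/
theorem kineticEnergy_datum (a b : ℝ) {N : ℕ} (hN : 2 ≤ N) :
    kineticEnergy (datum a b N) = (a ^ 2 + b ^ 2) / 4 := by
  rw [datum, kineticEnergy_realTrigPoly (modes_symm N) (isConjSymm_coef a b N), sum_modes hN,
    norm_coef_ax_one_sq a b hN, norm_coef_ax_neg_one_sq a b hN, norm_coef_ax_N_sq a b hN,
    norm_coef_ax_neg_N_sq a b hN]
  ring

/-- `‖∇u₀‖₂² = 2π²(a² + N²b²)` (spectral form). -/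
theorem toReal_eGradNormSq_datum (a b : ℝ) {N : ℕ} (hN : 2 ≤ N) :
    (eGradNormSq (datum a b N)).toReal = 2 * Real.pi ^ 2 * (a ^ 2 + (N:ℝ) ^ 2 * b ^ 2) := by
  rw [datum, toReal_eGradNormSq_realTrigPoly (modes_symm N) (isConjSymm_coef a b N),
    sum_modes hN, norm_coef_ax_one_sq a b hN, norm_coef_ax_neg_one_sq a b hN,
    norm_coef_ax_N_sq a b hN, norm_coef_ax_neg_N_sq a b hN, freqNormSq_ax, freqNormSq_ax,
    freqNormSq_ax, freqNormSq_ax]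
  push_cast
  ring

/-- `‖∇u₀‖₂² = 2π²(a² + N²b²)` (derivative form, `Torus.gradNormSq`). -/
theorem gradNormSq_datum (a b : ℝ) {N : ℕ} (hN : 2 ≤ N) :
    gradNormSq (datum a b N) = 2 * Real.pi ^ 2 * (a ^ 2 + (N:ℝ) ^ 2 * b ^ 2) := by
  rw [gradNormSq_eq_toReal_eGradNormSq_holds (isSmooth_datum a b N), toReal_eGradNormSq_datum a b hN]

/-! ## Shell sums against arbitrary finite frequency sets -/

/-- Squared Fourier norms of the datum: `‖û₀(ξ)‖² = 𝟙_{modes}(ξ) · amp(ξ)²/4`. -/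
theorem norm_sq_mFourierCoeff_datum (a b : ℝ) (N : ℕ) (ξ : Fin 3 → ℤ) :
    ‖mFourierCoeff (EuclideanSpace.complexify ∘ datum a b N) ξ‖ ^ 2 =
      if ξ ∈ modes N then (amp a b N ξ) ^ 2 / 4 else 0 := by
  rw [mFourierCoeff_datum]
  split_ifs with h
  · exact norm_coef_sq a b N ξ
  · simp

/-- `N e₀` is a mode. [folklore] -/
theorem ax_N_mem_modes (N : ℕ) : ax N ∈ modes N := by simp [modes]
/-- `−N e₀` is a mode. [folklore] -/
theorem ax_neg_N_mem_modes (N : ℕ) : ax (-(N:ℤ)) ∈ modes N := by simp [modes]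
/-- `e₀` is a mode. [folklore] -/
theorem ax_one_mem_modes (N : ℕ) : ax 1 ∈ modes N := by simp [modes]
/-- `−e₀` is a mode. [folklore] -/
theorem ax_neg_one_mem_modes (N : ℕ) : ax (-1) ∈ modes N := by simp [modes]

/-- **High-shell content of the datum**: for every finite frequency set `A` containing
`±N e₀` and every nonnegative weight `w`, `Σ_{ξ∈A} w ξ ‖û₀ ξ‖² ≥ (w(N e₀) + w(-N e₀)) b²/4`. -/
theorem sum_weight_norm_sq_datum_ge (a b : ℝ) {N : ℕ} (hN : 2 ≤ N) (A : Finset (Fin 3 → ℤ))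
    (hA : ax N ∈ A) (hA' : ax (-(N:ℤ)) ∈ A) (w : (Fin 3 → ℤ) → ℝ) (hw : ∀ ξ, 0 ≤ w ξ) :
    (w (ax N) + w (ax (-(N:ℤ)))) * (b ^ 2 / 4) ≤
      ∑ ξ ∈ A, w ξ * ‖mFourierCoeff (EuclideanSpace.complexify ∘ datum a b N) ξ‖ ^ 2 := by
  have hne : ax (N:ℤ) ≠ ax (-(N:ℤ)) := by rw [ne_eq, ax_inj]; omega
  have hsub : ({ax (N:ℤ), ax (-(N:ℤ))} : Finset (Fin 3 → ℤ)) ⊆ A := by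
    intro ξ hξ
    simp only [Finset.mem_insert, Finset.mem_singleton] at hξ
    rcases hξ with rfl | rfl
    · exact hA
    · exact hA'
  calc (w (ax N) + w (ax (-(N:ℤ)))) * (b ^ 2 / 4)
      = ∑ ξ ∈ ({ax (N:ℤ), ax (-(N:ℤ))} : Finset (Fin 3 → ℤ)),
          w ξ * ‖mFourierCoeff (EuclideanSpace.complexify ∘ datum a b N) ξ‖ ^ 2 := by
        rw [Finset.sum_pair hne, norm_sq_mFourierCoeff_datum, norm_sq_mFourierCoeff_datum,
          if_pos (ax_N_mem_modes N), if_pos (ax_neg_N_mem_modes N), amp_ax, amp_ax, prof_N a b hN,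
          prof_neg_N a b hN, neg_sq]
        ring
    _ ≤ ∑ ξ ∈ A, w ξ * ‖mFourierCoeff (EuclideanSpace.complexify ∘ datum a b N) ξ‖ ^ 2 :=
        Finset.sum_le_sum_of_subset_of_nonneg hsub fun ξ _ _ => mul_nonneg (hw ξ) (sq_nonneg _)

/-! ## Fixed-ledger normalisation: `a_N² + b_N² = 2`, `a_N² + N² b_N² = 4` -/

/-- `b_N = √(2/(N²-1))`. -/
def bN (N : ℕ) : ℝ := Real.sqrt (2 / ((N:ℝ) ^ 2 - 1))

/-- `a_N = √(2 - 2/(N²-1))`. -/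
def aN (N : ℕ) : ℝ := Real.sqrt (2 - 2 / ((N:ℝ) ^ 2 - 1))

/-- `b_N² = 2/(N² − 1)`. [folklore] -/
theorem bN_sq {N : ℕ} (hN : 2 ≤ N) : bN N ^ 2 = 2 / ((N:ℝ) ^ 2 - 1) := by
  have hN' : (2:ℝ) ≤ N := by exact_mod_cast hN
  rw [bN, Real.sq_sqrt]
  apply div_nonneg (by norm_num)
  nlinarith

/-- `a_N² = 2 − 2/(N² − 1)`. [folklore] -/
theorem aN_sq {N : ℕ} (hN : 2 ≤ N) : aN N ^ 2 = 2 - 2 / ((N:ℝ) ^ 2 - 1) := by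
  have hN' : (2:ℝ) ≤ N := by exact_mod_cast hN
  have h3 : (3:ℝ) ≤ (N:ℝ) ^ 2 - 1 := by nlinarith
  rw [aN, Real.sq_sqrt]
  rw [sub_nonneg, div_le_iff₀ (by linarith)]
  linarith

/-- Fixed energy ledger: `a_N² + b_N² = 2`. [folklore] -/
theorem aN_sq_add_bN_sq {N : ℕ} (hN : 2 ≤ N) : aN N ^ 2 + bN N ^ 2 = 2 := by
  rw [aN_sq hN, bN_sq hN]; ring

/-- Fixed enstrophy ledger: `a_N² + N² b_N² = 4`. [folklore] -/
theorem aN_sq_add_N_sq_bN_sq {N : ℕ} (hN : 2 ≤ N) : aN N ^ 2 + (N:ℝ) ^ 2 * bN N ^ 2 = 4 := by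
  have hN' : (2:ℝ) ≤ N := by exact_mod_cast hN
  have h3 : (N:ℝ) ^ 2 - 1 ≠ 0 := by nlinarith
  rw [aN_sq hN, bN_sq hN]
  field_simp
  ring

/-- The normalised datum has `½∫‖u₀‖² = 1/2`, `∫‖u₀‖² = 1`, `‖∇u₀‖₂² = 8π²` for every `N ≥ 2`. -/
theorem kineticEnergy_datum_norm {N : ℕ} (hN : 2 ≤ N) : kineticEnergy (datum (aN N) (bN N) N) = 1 / 2 := by
  rw [kineticEnergy_datum _ _ hN, aN_sq_add_bN_sq hN]; norm_num

/-- `‖∇u₀^{(N)}‖²₂ = 8π²` for every `N ≥ 2`. [folklore] -/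
theorem gradNormSq_datum_norm {N : ℕ} (hN : 2 ≤ N) : gradNormSq (datum (aN N) (bN N) N) = 8 * Real.pi ^ 2 := by
  rw [gradNormSq_datum _ _ hN, aN_sq_add_N_sq_bN_sq hN]; ring

/-- High-shell `|ξ|²`-content of the normalised datum stays above `1`: `N² b_N²/2 = N²/(N²-1) > 1`. -/
theorem N_sq_bN_sq_div_two_gt_one {N : ℕ} (hN : 2 ≤ N) : 1 < (N:ℝ) ^ 2 * bN N ^ 2 / 2 := by
  have hN' : (2:ℝ) ≤ N := by exact_mod_cast hN
  have h3 : 0 < (N:ℝ) ^ 2 - 1 := by nlinarith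
  rw [bN_sq hN, lt_div_iff₀ (by norm_num : (0:ℝ) < 2)]
  rw [show (N:ℝ) ^ 2 * (2 / ((N:ℝ) ^ 2 - 1)) = 2 * (N:ℝ) ^ 2 / ((N:ℝ) ^ 2 - 1) by ring,
    lt_div_iff₀ h3]
  nlinarith

/-- The flow is a classical Navier–Stokes solution on every `[0, T)`. [folklore] -/
theorem isClassicalNSSolutionOn_flow_Ico (ν a b : ℝ) (N : ℕ) (T : ℝ) :
    Torus.IsClassicalNSSolutionOn (Ico 0 T) ν 0 (flow ν a b N) (fun _ _ => (0 : ℝ)) :=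
  (isClassicalNSSolutionOn_flow ν a b N).mono Ico_subset_Ici_self (uniqueDiffOn_Ico 0 T)

end Summit.NavierStokesRegularity.NavierStokesRegularity.Theorems.Lietz2026
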